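import Summits.RiemannHypothesis.RiemannHypothesis.Theorems.SuzukiWindowsDoorExplicitWindowPolarWindows
import Summits.RiemannHypothesis.RiemannHypothesis.Theorems.SuzukiWindowsDoorTempleWindow
import Literature.Analysis.OperatorTheory.L2KernelIntegralOperator

/-!
# SuzukiWindowsDoorExplicitOpNorm — the explicit windows as OPERATOR-NORM contractions `‖𝖪_θ[t]‖ < 1` (column DBR; RH-FREE)

RH-FREE throughout; nothing here bears on the truth of RH (a contraction window certifies nothing about RH; each
is a finite instance of the `∀ t`-clause of the RH-EQUIVALENT residual `AllWindowsWitness`, never evidence for it).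
The B-P(P2) data target of the cell is `‖𝖪_θ[T]‖ < 1`; here it is typed in the tree's hypothesis style
(`SuzukiWindowsDoorTempleWindow`: ANY bounded `A` on `L²(−t,t)` with the a.e. kernel formula
`(Aφ)(x) = ∫_{(−t,t)} K(x+y)φ(y)dy`, no definition introduced) and PROVED for the explicit windows of
`SuzukiWindowsDoorExplicitWindowPolarWindows`:
* §1 `opNorm_winOp_le_sqrt` — Hilbert–Schmidt bound `‖A‖ ≤ √(∫_S∫_S K(x+y)²)` (continuous `K`), and for one-sided
  `K` (`K = 0` on `(−∞,0)`) `‖A‖ ≤ √h(t)`, `h(t) = ∫₀^{2t}(2t−u)K(u)² du` (`SuzukiHSWindow.sq_integral_window_eq_weighted`);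
  hence `h(t) < 1 ⇒ ‖A‖ < 1` (which is stronger than `NoUnitEigenvalue`);
* §2 for `K_θ`: the rational evaluation form of the polar envelope gives `h(T) < 1`, so `‖A‖ < 1` for every window
  `t ≤ T`; instances `θ = 12: t ≤ 1/2`, `θ = 20: t ≤ 0.84`, `θ = 40: t ≤ 8/5`.
Numerics of record for comparison (NOT kernel): certified `‖𝖪₁₂[t]‖ < 1` to `t = 1.4`, `‖𝖪₂₀[t]‖ < 1` to `t = 1.5`
(two interval lineages, DATA §ET1c).
-/

noncomputable section

-- D-0017: `Summit.<S>.<S>.…` is the designed namespace of a single-problem summit.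
set_option linter.dupNamespace false

open MeasureTheory Set Filter Function

namespace Summit.RiemannHypothesis.RiemannHypothesis.Theorems.SuzukiWindowsDoorExplicitOpNorm

open Literature.NumberTheory.LFunctions Literature.Analysis.OperatorTheory
open Summit.RiemannHypothesis.RiemannHypothesis.Theorems.SuzukiWindowsDoorTempleGalerkin
open Summit.RiemannHypothesis.RiemannHypothesis.Theorems.SuzukiWindowsDoorExplicitWindowPolar
open Summit.RiemannHypothesis.RiemannHypothesis.Theorems.SuzukiWindowsDoorExplicitWindowPolarWindows

/-! ## §1 `‖A‖ ≤ √(∫∫ K²) = √h(t)` for window operators -/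

section Window

variable {K : ℝ → ℝ} {t : ℝ}
  {A : Lp ℝ 2 (volume.restrict (Ioo (-t) t)) →L[ℝ] Lp ℝ 2 (volume.restrict (Ioo (-t) t))}

/-- **Hilbert–Schmidt bound for a window operator** (RH-free, K-general): for continuous `K` and any bounded `A`
on `L²(−t,t)` with the kernel formula, `‖A‖ ≤ √(∫_{(−t,t)}∫_{(−t,t)} K(x+y)² dy dx)`. -/
theorem opNorm_winOp_le_sqrt (hK : Continuous K)
    (hA : ∀ φ, (A φ : ℝ → ℝ) =ᵐ[volume.restrict (Ioo (-t) t)] fun x => ∫ y in Ioo (-t) t, K (x + y) * φ y) :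
    ‖A‖ ≤ Real.sqrt (∫ x in Ioo (-t) t, ∫ y in Ioo (-t) t, K (x + y) ^ 2) := by
  refine ContinuousLinearMap.opNorm_le_bound _ (Real.sqrt_nonneg _) fun φ => ?_
  have hKK := memLp_winKernel hK t
  have h1 := norm_toLp_integral_l2Kernel_mul_le hKK φ
  have h2 : A φ = (memLp_two_integral_l2Kernel_mul hKK φ).toLp _ :=
    Lp.ext ((hA φ).trans (MemLp.coeFn_toLp _).symm)
  have hint : Integrable (fun z : ℝ × ℝ => K (z.1 + z.2) ^ 2)
      ((volume.restrict (Ioo (-t) t)).prod (volume.restrict (Ioo (-t) t))) := hKK.integrable_sq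
  have h3 : ∫ z, K (z.1 + z.2) ^ 2 ∂((volume.restrict (Ioo (-t) t)).prod (volume.restrict (Ioo (-t) t)))
      = ∫ x in Ioo (-t) t, ∫ y in Ioo (-t) t, K (x + y) ^ 2 :=
    integral_prod (fun z : ℝ × ℝ => K (z.1 + z.2) ^ 2) hint
  rw [h2, ← h3]
  exact h1

/-- One-sided kernels (`K = 0` on `(−∞,0)`), `t > 0`: `‖A‖ ≤ √h(t)`, `h(t) = ∫₀^{2t} (2t − u) K(u)² du`. -/
theorem opNorm_winOp_le_sqrt_weightedSq (hK : Continuous K) (h0 : ∀ u : ℝ, u < 0 → K u = 0) (ht : 0 < t)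
    (hA : ∀ φ, (A φ : ℝ → ℝ) =ᵐ[volume.restrict (Ioo (-t) t)] fun x => ∫ y in Ioo (-t) t, K (x + y) * φ y) :
    ‖A‖ ≤ Real.sqrt (∫ u in (0 : ℝ)..(2 * t), (2 * t - u) * K u ^ 2) := by
  rw [← SuzukiHSWindow.sq_integral_window_eq_weighted hK h0 ht]
  exact opNorm_winOp_le_sqrt hK hA

/-- **`h(t) < 1 ⇒ ‖A‖ < 1`** (RH-free, K-general, one-sided continuous `K`, any real `t`): the weighted
Hilbert–Schmidt test gives an operator-norm CONTRACTION window (stronger than `NoUnitEigenvalue K t`). -/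
theorem opNorm_winOp_lt_one_of_weightedSq_lt_one (hK : Continuous K) (h0 : ∀ u : ℝ, u < 0 → K u = 0)
    (h : ∫ u in (0 : ℝ)..(2 * t), (2 * t - u) * K u ^ 2 < 1)
    (hA : ∀ φ, (A φ : ℝ → ℝ) =ᵐ[volume.restrict (Ioo (-t) t)] fun x => ∫ y in Ioo (-t) t, K (x + y) * φ y) :
    ‖A‖ < 1 := by
  rcases le_or_gt t 0 with ht | ht
  · have hb := opNorm_winOp_le_sqrt hK hA
    have hvol : volume (Ioo (-t) t) = 0 := by rw [Ioo_eq_empty (by linarith), measure_empty]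
    rw [setIntegral_measure_zero _ hvol, Real.sqrt_zero] at hb
    linarith
  · calc ‖A‖ ≤ Real.sqrt (∫ u in (0 : ℝ)..(2 * t), (2 * t - u) * K u ^ 2) :=
          opNorm_winOp_le_sqrt_weightedSq hK h0 ht hA
      _ < 1 := (Real.sqrt_lt' one_pos).2 (by rw [one_pow]; exact h)

end Window

/-! ## §2 `K_θ`: contraction windows from the polar envelope -/

/-- `h_θ(T) < 1` from the rational test of `noUnitEigenvalue_limKernel_polar_of_rat_bounds` (same hypotheses). -/
theorem weightedSq_lt_one_of_rat_bounds {n m N : ℕ} (hn : 2 ≤ n) (hm : 3 ≤ m)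
    {T p q r α θe : ℝ} (hp : Real.pi ≤ p) (hq : Real.exp 1 ≤ q) (hθe : 2 ≤ θe)
    (hθea : θe + 2 * (3 * n * (2 * T) / (n - 1) - 2 * n * (2 * T) ^ 2 / (n - 1) ^ 2) ≤ n)
    (hr : Real.sqrt (2 / θe) ≤ r)
    (ha : 2 * n * (1 / (6 * (m : ℝ) ^ 2) + 1 / (3 * (m : ℝ) ^ 3) + p ^ 2 / 6 * (8 / 2 ^ m)) ≤ α) (ha1 : α ≤ 1)
    (hT : 0 < T) (hTm : 2 * T * m ≤ n - 1)
    (hl : 0 < (2 * n - 2) / (2 * T) - (1 + 6 * n / (n - 1) - 4 * n * (2 * T) / (n - 1) ^ 2))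
    (hc0 : 0 ≤ 1 + 6 * n / (n - 1) - 4 * n * (2 * T) / (n - 1) ^ 2)
    (hcond : ((2 * p) ^ (n - 1) * (p * r) * (q / (n - 1)) ^ (n - 1) * (1 + α + α ^ 2)) ^ 2
        * (2 * T) ^ (2 * n - 2)
        < ((2 * n - 2) / (2 * T) - (1 + 6 * n / (n - 1) - 4 * n * (2 * T) / (n - 1) ^ 2)) ^ 2
          * ∑ i ∈ Finset.range N,
            ((1 + 6 * n / (n - 1) - 4 * n * (2 * T) / (n - 1) ^ 2) * (2 * T)) ^ i / (i.factorial : ℝ)) :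
    ∫ u in (0 : ℝ)..(2 * T), (2 * T - u) * limKernel n u ^ 2 < 1 := by
  have hn' : (2 : ℝ) ≤ n := by exact_mod_cast hn
  have hm' : (3 : ℝ) ≤ m := by exact_mod_cast hm
  have hn1 : 0 < (n : ℝ) - 1 := by linarith
  have hm0 : 0 < (m : ℝ) := by linarith
  have hp0 : 0 ≤ p := Real.pi_pos.le.trans hp
  have hr0 : 0 ≤ r := (Real.sqrt_nonneg _).trans hr
  have hq0 : 0 ≤ q := (Real.exp_pos 1).le.trans hq
  refine (weightedSq_limKernel_le_polar hm' hT hTm hθe hθea hl).trans_lt ?_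
  set X : ℝ := 2 * T with hX
  set c : ℝ := 1 + 6 * n / (n - 1) - 4 * n * X / (n - 1) ^ 2 with hc
  set l : ℝ := (2 * n - 2) / X - c with hldef
  set S : ℝ := ∑ i ∈ Finset.range N, (c * X) ^ i / (i.factorial : ℝ) with hS
  have hX0 : 0 < X := by rw [hX]; linarith
  have hcast : ((n : ℝ) - 1) = ((n - 1 : ℕ) : ℝ) := by
    rw [Nat.cast_sub (by omega)]; simp
  have hrp : ∀ x : ℝ, x ^ ((n : ℝ) - 1) = x ^ (n - 1) := fun x => by rw [hcast, Real.rpow_natCast]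
  have hrp2 : ∀ x : ℝ, x ^ (2 * (n : ℝ) - 2) = x ^ (2 * n - 2) := fun x => by
    rw [show (2 : ℝ) * n - 2 = ((2 * n - 2 : ℕ) : ℝ) by
      rw [Nat.cast_sub (by omega)]; push_cast; ring, Real.rpow_natCast]
  have hε : 1 / (6 * (m : ℝ) ^ 2) + 1 / (Real.pi * (m : ℝ) ^ 3) + Real.pi ^ 2 / 6 * (2 : ℝ) ^ ((3 : ℝ) - m)
      ≤ 1 / (6 * (m : ℝ) ^ 2) + 1 / (3 * (m : ℝ) ^ 3) + p ^ 2 / 6 * (8 / 2 ^ m) := by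
    have h1 : 1 / (Real.pi * (m : ℝ) ^ 3) ≤ 1 / (3 * (m : ℝ) ^ 3) := by
      have := Real.pi_gt_three.le; gcongr
    have h2 : (2 : ℝ) ^ ((3 : ℝ) - m) = 8 / 2 ^ m := by
      rw [Real.rpow_sub (by norm_num), Real.rpow_natCast, show (3 : ℝ) = ((3 : ℕ) : ℝ) by norm_num,
        Real.rpow_natCast]
      norm_num
    have h3 : Real.pi ^ 2 / 6 * (2 : ℝ) ^ ((3 : ℝ) - m) ≤ p ^ 2 / 6 * (8 / 2 ^ m) := by
      rw [h2]; gcongr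
    linarith
  have hα0 : 0 ≤ α := le_trans (by positivity) ha
  have hE : Real.exp (2 * n * (1 / (6 * (m : ℝ) ^ 2) + 1 / (Real.pi * (m : ℝ) ^ 3)
      + Real.pi ^ 2 / 6 * (2 : ℝ) ^ ((3 : ℝ) - m))) ≤ 1 + α + α ^ 2 := by
    have h := (abs_le.mp (Real.abs_exp_sub_one_sub_id_le (x := α) (by rwa [abs_of_nonneg hα0]))).2
    calc Real.exp (2 * n * (1 / (6 * (m : ℝ) ^ 2) + 1 / (Real.pi * (m : ℝ) ^ 3)
          + Real.pi ^ 2 / 6 * (2 : ℝ) ^ ((3 : ℝ) - m)))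
        ≤ Real.exp α := Real.exp_le_exp.mpr ((mul_le_mul_of_nonneg_left hε (by positivity)).trans ha)
      _ ≤ 1 + α + α ^ 2 := by linarith
  have hS0 : 0 < S := by
    have h0 : (0 : ℝ) ≤ ((2 * p) ^ (n - 1) * (p * r) * (q / (n - 1)) ^ (n - 1) * (1 + α + α ^ 2)) ^ 2
        * X ^ (2 * n - 2) := by positivity
    have h1 : 0 < l ^ 2 * S := lt_of_le_of_lt h0 hcond
    exact pos_of_mul_pos_right h1 (sq_nonneg _)
  have hexpS : Real.exp (-(c * X)) ≤ 1 / S := by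
    rw [Real.exp_neg, ← one_div]
    exact one_div_le_one_div_of_le hS0 (Real.sum_le_exp_of_nonneg (mul_nonneg hc0 hX0.le) N)
  rw [div_lt_one (by positivity), hrp, hrp, hrp2]
  calc ((2 * Real.pi) ^ (n - 1) * (Real.pi * Real.sqrt (2 / θe)) * (Real.exp 1 / (n - 1)) ^ (n - 1)
        * Real.exp (2 * n * (1 / (6 * (m : ℝ) ^ 2) + 1 / (Real.pi * (m : ℝ) ^ 3)
          + Real.pi ^ 2 / 6 * (2 : ℝ) ^ ((3 : ℝ) - m)))) ^ 2 * (X ^ (2 * n - 2) * Real.exp (-(c * X)))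
      ≤ ((2 * p) ^ (n - 1) * (p * r) * (q / (n - 1)) ^ (n - 1) * (1 + α + α ^ 2)) ^ 2
        * (X ^ (2 * n - 2) * (1 / S)) := by gcongr
    _ = ((2 * p) ^ (n - 1) * (p * r) * (q / (n - 1)) ^ (n - 1) * (1 + α + α ^ 2)) ^ 2
        * X ^ (2 * n - 2) / S := by ring
    _ < l ^ 2 := by rw [div_lt_iff₀ hS0]; exact hcond

/-- **`‖A‖ < 1` for every window `t ≤ T` of `K_θ`, from `h_θ(T) < 1`** (RH-free; monotonicity of `h` in the
window and §1). -/
theorem opNorm_winOp_limKernel_lt_one {θ T t : ℝ} (hθ : 1 < θ)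
    (hT : ∫ u in (0 : ℝ)..(2 * T), (2 * T - u) * limKernel θ u ^ 2 < 1) (ht : t ≤ T)
    {A : Lp ℝ 2 (volume.restrict (Ioo (-t) t)) →L[ℝ] Lp ℝ 2 (volume.restrict (Ioo (-t) t))}
    (hA : ∀ φ, (A φ : ℝ → ℝ) =ᵐ[volume.restrict (Ioo (-t) t)]
      fun x => ∫ y in Ioo (-t) t, limKernel θ (x + y) * φ y) :
    ‖A‖ < 1 := by
  have hK := Suzuki2020_thm12_continuous hθ
  have h0 : ∀ u : ℝ, u < 0 → limKernel θ u = 0 := fun u hu => Suzuki2020_thm12_Kiii hθ hu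
  refine opNorm_winOp_lt_one_of_weightedSq_lt_one hK h0 ?_ hA
  rcases le_or_gt t 0 with ht0 | ht0
  · -- `h(t) = 0` for `t ≤ 0`
    have : ∫ u in (0 : ℝ)..(2 * t), (2 * t - u) * limKernel θ u ^ 2 = ∫ u in (0 : ℝ)..(2 * t), (0 : ℝ) := by
      refine intervalIntegral.integral_congr fun u hu => ?_
      have hu0 : u ≤ 0 := by rw [uIcc_of_ge (by linarith)] at hu; exact hu.2
      simp [SuzukiHSWindow.sq_eq_zero_of_nonpos hK h0 hu0]
    rw [this, intervalIntegral.integral_zero]; norm_num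
  · exact (weightedSq_mono hK ht0.le ht).trans_lt hT


/-- **θ = 12: `‖𝖪₁₂[t]‖ < 1` for every `t ≤ 1/2`** (RH-free; any bounded `A` on `L²(−t,t)` with the kernel formula
for `K₁₂`).  Numerics of record (NOT kernel): certified `‖𝖪₁₂[t]‖ < 1` up to `t = 1.4` (DATA §ET1c). -/
theorem opNorm_winOp_limKernel_twelve_lt_one {t : ℝ} (ht : t ≤ 1 / 2)
    {A : Lp ℝ 2 (volume.restrict (Ioo (-t) t)) →L[ℝ] Lp ℝ 2 (volume.restrict (Ioo (-t) t))}
    (hA : ∀ φ, (A φ : ℝ → ℝ) =ᵐ[volume.restrict (Ioo (-t) t)]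
      fun x => ∫ y in Ioo (-t) t, limKernel 12 (x + y) * φ y) :
    ‖A‖ < 1 := by
  have h := weightedSq_lt_one_of_rat_bounds (n := 12) (m := 11) (N := 30) (by norm_num)
    (by norm_num) (T := 1 / 2) (p := 3.1416) (q := 2.7182818286) (r := 11693 / 20000)
    (α := 96641 / 500000) (θe := 708 / 121) Real.pi_lt_d4.le Real.exp_one_lt_d9.le (by norm_num)
    (by norm_num) (by rw [Real.sqrt_le_left (by norm_num)]; norm_num) (by norm_num) (by norm_num)
    (by norm_num) (by norm_num) (by norm_num) (by norm_num)
    (by norm_num [Finset.sum_range_succ, Nat.factorial])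
  have h' : ∫ u in (0 : ℝ)..(2 * (1 / 2)), (2 * (1 / 2) - u) * limKernel 12 u ^ 2 < 1 := by exact_mod_cast h
  exact opNorm_winOp_limKernel_lt_one (θ := 12) (by norm_num) h' ht hA

/-- **θ = 20: `‖𝖪₂₀[t]‖ < 1` for every `t ≤ 21/25 = 0.84`** (RH-free).  Numerics of record: to `t = 1.5` (§ET1c). -/
theorem opNorm_winOp_limKernel_twenty_lt_one {t : ℝ} (ht : t ≤ 21 / 25)
    {A : Lp ℝ 2 (volume.restrict (Ioo (-t) t)) →L[ℝ] Lp ℝ 2 (volume.restrict (Ioo (-t) t))}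
    (hA : ∀ φ, (A φ : ℝ → ℝ) =ᵐ[volume.restrict (Ioo (-t) t)]
      fun x => ∫ y in Ioo (-t) t, limKernel 20 (x + y) * φ y) :
    ‖A‖ < 1 := by
  have h := weightedSq_lt_one_of_rat_bounds (n := 20) (m := 11) (N := 30) (by norm_num)
    (by norm_num) (T := 21 / 25) (p := 3.1416) (q := 2.7182818286) (r := 2793 / 6250)
    (α := 322137 / 1000000) (θe := 451924 / 45125) Real.pi_lt_d4.le Real.exp_one_lt_d9.le (by norm_num)
    (by norm_num) (by rw [Real.sqrt_le_left (by norm_num)]; norm_num) (by norm_num) (by norm_num)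
    (by norm_num) (by norm_num) (by norm_num) (by norm_num)
    (by norm_num [Finset.sum_range_succ, Nat.factorial])
  have h' : ∫ u in (0 : ℝ)..(2 * (21 / 25)), (2 * (21 / 25) - u) * limKernel 20 u ^ 2 < 1 := by
    exact_mod_cast h
  exact opNorm_winOp_limKernel_lt_one (θ := 20) (by norm_num) h' ht hA

/-- **θ = 40: `‖𝖪₄₀[t]‖ < 1` for every `t ≤ 8/5`** (RH-free). -/
theorem opNorm_winOp_limKernel_forty_lt_one {t : ℝ} (ht : t ≤ 8 / 5)
    {A : Lp ℝ 2 (volume.restrict (Ioo (-t) t)) →L[ℝ] Lp ℝ 2 (volume.restrict (Ioo (-t) t))}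
    (hA : ∀ φ, (A φ : ℝ → ℝ) =ᵐ[volume.restrict (Ioo (-t) t)]
      fun x => ∫ y in Ioo (-t) t, limKernel 40 (x + y) * φ y) :
    ‖A‖ < 1 := by
  have h := weightedSq_lt_one_of_rat_bounds (n := 40) (m := 12) (N := 32) (by norm_num)
    (by norm_num) (T := 8 / 5) (p := 3.1416) (q := 2.7182818286) (r := 15291 / 50000)
    (α := 365047 / 1000000) (θe := 162632 / 7605) Real.pi_lt_d4.le Real.exp_one_lt_d9.le (by norm_num)
    (by norm_num) (by rw [Real.sqrt_le_left (by norm_num)]; norm_num) (by norm_num) (by norm_num)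
    (by norm_num) (by norm_num) (by norm_num) (by norm_num)
    (by norm_num [Finset.sum_range_succ, Nat.factorial])
  have h' : ∫ u in (0 : ℝ)..(2 * (8 / 5)), (2 * (8 / 5) - u) * limKernel 40 u ^ 2 < 1 := by exact_mod_cast h
  exact opNorm_winOp_limKernel_lt_one (θ := 40) (by norm_num) h' ht hA

end Summit.RiemannHypothesis.RiemannHypothesis.Theorems.SuzukiWindowsDoorExplicitOpNorm

end
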